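import Literature.Computability.Cryptography.PeriodFindingFamily
import Literature.Computability.Cryptography.QuantumCircuitDescFP
import Literature.Computability.QuantumComplexity.RevTableauUniform
import Literature.Computability.Complexity.CodeFP
import HarnessLib

/-!
# Period finding by eigenvalue estimation of shifts, X: the description of the family

Family `PQC` / quantum-advantage barrier `PPolyOracles`; tenth file towards the discharge of
`Literature.Barriers.QuantumAdvantage.aaronsonChen2017_lem75_quantum`. Towards the uniformity of
the quantum core `family P` (`PeriodFindingFamily.lean`) we compute its description in closed
form. Gates of Clifford+T circuits WITH oracle gates are abstracted as triples
`(oracle?, symbol code | query length, wires)` (`AO`, `toAO`) whose code `aoE` is the layout of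
`QGate.encode` (`encode_eq_aoE`), so that the description of a circuit is the raw list of the codes
of its abstract gates (`encode_eq_rawE_aoE`; the oracle-free case is `AJLCore.encode_eq_rawE`).
The abstract gates of a compiled `RtOp` program of classical operations and queries are computed
operation by operation (`map_toAO_compileList`: `X = HSSH`, `CNOT`, the Toffoli word of
Nielsen–Chuang Fig. 4.9 by `RevDesc.agates`, one oracle gate per query), and the values of the
placed structured wires are affine (`natAddr_*`), whence the abstract gate list of the sandwich
circuit (`aoCirc`, `map_toAO_circ`) and the description of the family (`sigmaEncode_family`).

## References

* S. Arora, B. Barak, *Computational Complexity: A Modern Approach*, CUP 2009, §6.1–§6.2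
  (descriptions of circuits; P-uniform families) [AroraBarak2009].
* M. A. Nielsen, I. L. Chuang, *Quantum Computation and Quantum Information*, CUP 2010, §4.3
  Fig. 4.9 [NielsenChuang2010].
-/

noncomputable section

namespace Literature.Computability.Cryptography

namespace PeriodFinding

open QuantumComplexity QuantumComplexity.RazTalMachine QuantumComplexity.RevSim QuantumComplexity.OSim
  QuantumComplexity.RevDesc Complexity Complexity.CodeFP _root_.Computability Finset Function Kitaev1995

/-! ### Codes of gates with oracle gates -/

/-- **Abstract gates**: `(oracle?, symbol code or query length, wires)`. [cite: AroraBarak2009, §6.1] -/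
abbrev AO : Type := Bool × ℕ × List ℕ

/-- The code of an abstract gate: the layout of `QGate.encode` (tag bit, a binary numeral, the
wires as a list of binary numerals). [cite: AroraBarak2009, §6.1] -/
def aoE : AO → List Bool := fun t => t.1 :: pairE natE (listE natE) t.2

/-- The abstraction of a placed gate. [folklore] -/
def toAO {N : ℕ} : QGate cliffordT N → AO
  | .gate g e => (false, symCode g, List.ofFn fun i => (e i : ℕ))
  | .oracle k e => (true, k, List.ofFn fun i => (e i : ℕ))

/-- The symbol code is the `Encodable` code. [folklore] -/
theorem symCode_eq_encode' (g : CliffordTOp) : symCode g = Encodable.encode g := by cases g <;> rfl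

/-- **The code of a placed gate is the code of its abstraction.** [cite: AroraBarak2009, §6.1] -/
theorem encode_eq_aoE {N : ℕ} (g : QGate cliffordT N) : g.encode = aoE (toAO g) := by
  cases g with
  | gate g e =>
    rw [QGate.encode, aoE, toAO]
    simp only [pairE]
    rw [symCode_eq_encode', listE_eq]
    rfl
  | oracle k e =>
    rw [QGate.encode, aoE, toAO]
    simp only [pairE]
    rw [listE_eq]
    rfl

/-- **The description of a circuit is the raw list of the codes of its abstract gates.** [cite: AroraBarak2009, §6.1] -/
theorem encode_eq_rawE_aoE {N : ℕ} (C : QCircuit cliffordT N) : C.encode = rawE aoE (C.gates.map toAO) := by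
  rw [QCircuit.encode_eq_encList, rawE, List.map_map]
  congr 1
  exact List.map_congr_left fun g _ => encode_eq_aoE g

/-- The abstraction of an abstract Clifford+T gate of `RevDesc`. [folklore] -/
def aoOfAG (a : AGate ℕ) : AO := (false, symCode a.sym, a.wires)

/-- The abstract gates of a classical operation on `ℕ` wires (`X = HSSH`, `CNOT`, the Toffoli
word). [cite: NielsenChuang2010, §4.3 Fig. 4.9] -/
def aoCl (op : ClOp ℕ) : List AO := (agates op).map aoOfAG

/-- **The abstract gates of a compiled operation** (classical operations and queries). [folklore] -/
def aoOfRt {N : ℕ} : RtOp (Fin N) → List AO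
  | .cl op => aoCl (op.map Fin.val)
  | .oracle qs t => [(true, qs.length, (qs ++ [t]).map Fin.val)]
  | .had a => [(false, 0, [(a : ℕ)])]
  | .chad _ _ => []

/-- The compiled word of a classical operation, abstractly. [cite: NielsenChuang2010, §4.3 Fig. 4.9] -/
theorem map_toAO_toRev_compile {N : ℕ} (op : ClOp (Fin N)) (h : op.WF) :
    (op.toRev h).compile.map toAO = aoCl (op.map Fin.val) := by
  cases op with
  | not i => rfl
  | cnot i j => rfl
  | toffoli a b c => rfl

/-- **The compiled operation, abstractly.** [folklore] -/
theorem map_toAO_compile {N : ℕ} (op : RtOp (Fin N)) (hcl : IsCl op) (h : op.WF) :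
    (op.compile h).map toAO = aoOfRt op := by
  cases op with
  | cl op => exact map_toAO_toRev_compile op h
  | had a => exact absurd hcl id
  | chad c a => exact absurd hcl id
  | oracle qs t =>
    show [toAO (QGate.oracle qs.length (oracleEmb qs t h))] = [(true, qs.length, (qs ++ [t]).map Fin.val)]
    simp only [toAO, List.cons.injEq, and_true, Prod.mk.injEq, true_and]
    apply List.ext_getElem (by simp)
    intro i h1 h2
    simp only [List.getElem_ofFn, oracleEmb, Function.Embedding.coeFn_mk, List.get_eq_getElem, Fin.val_cast,
      List.getElem_map]

/-- **The compiled program, abstractly**: the concatenation of the abstract words. [folklore] -/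
theorem map_toAO_compileList {N : ℕ} : ∀ (ops : List (RtOp (Fin N))) (_ : ∀ op ∈ ops, IsCl op)
    (h : ∀ op ∈ ops, op.WF), (RtOp.compileList ops h).map toAO = ops.flatMap aoOfRt
  | [], _, _ => rfl
  | op :: ops, hcl, h => by
    rw [RtOp.compileList, List.map_append, map_toAO_compile op (hcl op (by simp)),
      map_toAO_compileList ops (fun o ho => hcl o (by simp [ho])), List.flatMap_cons]

/-! ### The values of the placed wires -/

variable (S : BSpec) (n : ℕ)

/-- The `ℕ`-value of the wire of a structured wire. [folklore] -/
def natAddr (a : BW S) : ℕ := (finAddr S n a : ℕ)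

variable {S n}

/-- Value of the step-region equivalence. [folklore] -/
theorem val_stepEquiv (v : Fin S.Ltop ⊕ (Fin S.Ltop ⊕ Fin (S.Ltop + 1))) :
    (stepEquiv S v : ℕ) = match v with
      | Sum.inl i => (i : ℕ)
      | Sum.inr (Sum.inl i) => S.Ltop + i
      | Sum.inr (Sum.inr i) => S.Ltop + (S.Ltop + i) := by
  rcases v with i | i | i <;> simp [stepEquiv]

/-- Value of the unit-region equivalence. [folklore] -/
theorem val_unitEquiv (v : (Fin S.K × (Fin S.Ltop ⊕ (Fin S.Ltop ⊕ Fin (S.Ltop + 1)))) ⊕ Fin S.Ltop) :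
    (unitEquiv S v : ℕ) = match v with
      | Sum.inl (s, w) => (stepEquiv S w : ℕ) + ssz S * s
      | Sum.inr i => S.K * ssz S + i := by
  rcases v with ⟨s, w⟩ | i <;> simp [unitEquiv]

/-- Value of the work-region equivalence. [folklore] -/
theorem val_workEquiv (v : WIdx S) :
    (workEquiv S v : ℕ) = match v with
      | Sum.inl q => (q : ℕ)
      | Sum.inr (u, w) => S.Ltop * S.plen + ((unitEquiv S w : ℕ) + usz S * u) := by
  rcases v with q | ⟨u, w⟩ <;> simp [workEquiv]

/-- Control wires. [folklore] -/
theorem natAddr_ctrl (u : Fin S.nU) (s : Fin S.K) : natAddr S n (BW.ctrl u s) = n + (s + S.K * u) := by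
  simp [natAddr, finAddr, place, code, val_yWire]

/-- Offset wires. [folklore] -/
theorem natAddr_zbit (u : Fin S.nU) (i : Fin S.Ltop) : natAddr S n (BW.zbit u i) = n + (k₁ S + (i + S.Ltop * u)) := by
  simp [natAddr, finAddr, place, code, val_zWire]

/-- Prefix wires. [folklore] -/
theorem natAddr_pre (j : Fin S.Ltop) (p : Fin S.plen) :
    natAddr S n (BW.pre j p) = n + ((k₁ S + k₂ S) + (p + S.plen * j)) := by
  simp [natAddr, finAddr, place, code, val_workWire, val_workEquiv]

/-- Fan-out registers. [folklore] -/
theorem natAddr_dreg (u : Fin S.nU) (s : Fin S.K) (i : Fin S.Ltop) :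
    natAddr S n (BW.dreg u s i) = n + ((k₁ S + k₂ S) + (S.Ltop * S.plen + ((i + ssz S * s) + usz S * u))) := by
  simp [natAddr, finAddr, place, code, val_workWire, val_workEquiv, val_unitEquiv, val_stepEquiv]

/-- Sum registers. [folklore] -/
theorem natAddr_sreg (u : Fin S.nU) (s : Fin S.K) (i : Fin S.Ltop) :
    natAddr S n (BW.sreg u s i) = n + ((k₁ S + k₂ S) + (S.Ltop * S.plen + (((S.Ltop + i) + ssz S * s) + usz S * u))) := by
  simp [natAddr, finAddr, place, code, val_workWire, val_workEquiv, val_unitEquiv, val_stepEquiv]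

/-- Carry registers. [folklore] -/
theorem natAddr_creg (u : Fin S.nU) (s : Fin S.K) (i : Fin (S.Ltop + 1)) :
    natAddr S n (BW.creg u s i) =
      n + ((k₁ S + k₂ S) + (S.Ltop * S.plen + (((S.Ltop + (S.Ltop + i)) + ssz S * s) + usz S * u))) := by
  simp [natAddr, finAddr, place, code, val_workWire, val_workEquiv, val_unitEquiv, val_stepEquiv]

/-- Answer registers. [folklore] -/
theorem natAddr_yreg (u : Fin S.nU) (i : Fin S.Ltop) :
    natAddr S n (BW.yreg u i) = n + ((k₁ S + k₂ S) + (S.Ltop * S.plen + ((S.K * ssz S + i) + usz S * u))) := by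
  simp [natAddr, finAddr, place, code, val_workWire, val_workEquiv, val_unitEquiv]

/-! ### The abstract gate list of the circuit -/

variable (S n)

/-- The compute part on `ℕ` wires. [folklore] -/
def wOpsNat : List (ClOp ℕ) := (wOps S).map (ClOp.map (natAddr S n))

/-- The abstract gates of one query. [folklore] -/
def aoQuery (a : Σ u : Fin S.nU, Fin (S.L u)) : AO :=
  (true, (qWires S a).length, (qWires S a).map (natAddr S n) ++ [natAddr S n (qTgt S a)])

/-- **The abstract gates of the compiled block**: compute words, one oracle gate per query,
uncompute words. [folklore] -/
def aoBlock : List AO :=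
  (wOpsNat S n).flatMap aoCl ++ (qIdx S).map (aoQuery S n) ++ (wOpsNat S n).reverse.flatMap aoCl

/-- The abstract gates of a placed operation of the block. [folklore] -/
theorem aoOfRt_map_finAddr (op : RtOp (BW S)) :
    aoOfRt (op.map (finAddr S n)) = match op with
      | .cl op => aoCl (op.map (natAddr S n))
      | .oracle qs t => [(true, qs.length, qs.map (natAddr S n) ++ [natAddr S n t])]
      | .had a => [(false, 0, [natAddr S n a])]
      | .chad _ _ => [] := by
  cases op with
  | cl op =>
    simp only [RtOp.map, aoOfRt]
    congr 1
    cases op <;> rfl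
  | oracle qs t => simp [RtOp.map, aoOfRt, natAddr]
  | had a => rfl
  | chad c a => rfl

/-- The abstract gates of placed classical operations. [folklore] -/
theorem flatMap_aoOfRt_cl (l : List (ClOp (BW S))) :
    (l.map RtOp.cl).flatMap (fun op => aoOfRt (op.map (finAddr S n))) = (l.map (ClOp.map (natAddr S n))).flatMap aoCl := by
  induction l with
  | nil => rfl
  | cons op l ih =>
    rw [List.map_cons, List.map_cons, List.flatMap_cons, List.flatMap_cons, ih, aoOfRt_map_finAddr]

/-- The abstract gates of the placed queries. [folklore] -/
theorem flatMap_aoOfRt_qOps :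
    (qOps S).flatMap (fun op => aoOfRt (op.map (finAddr S n))) = (qIdx S).map (aoQuery S n) := by
  rw [qOps, List.flatMap_map, List.map_eq_flatMap]
  refine List.flatMap_congr fun a _ => ?_
  show aoOfRt ((RtOp.oracle (qWires S a) (qTgt S a)).map (finAddr S n)) = [aoQuery S n a]
  rw [aoOfRt_map_finAddr]
  rfl

/-- **The gates of the compiled block, abstractly.** [folklore] -/
theorem map_toAO_blockCirc : (blockCirc S n).gates.map toAO = aoBlock S n := by
  rw [blockCirc, map_toAO_compileList _ (blockOpsN_isCl S n), blockOpsN, List.flatMap_map, blockOps]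
  simp only [List.flatMap_append]
  rw [flatMap_aoOfRt_cl, flatMap_aoOfRt_qOps, flatMap_aoOfRt_cl, List.map_reverse]
  rfl

/-- The Hadamard layer on the first `k` coin wires, abstractly. [folklore] -/
def aoHad (k : ℕ) : List AO := (List.range k).map fun j => (false, 0, [n + j])

/-- The phase layer, abstractly (`σ` on `ℕ`, `false` beyond `k₁`). [folklore] -/
def aoPhase (k : ℕ) (σ : ℕ → Bool) : List AO :=
  (List.range k).flatMap fun j => if σ j then [(false, 1, [n + j]), (false, 1, [n + j]), (false, 1, [n + j])] else []

/-- The flags of the phase layer as a function on `ℕ`. [folklore] -/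
def σNat (σ : Fin (k₁ S) → Bool) (j : ℕ) : Bool := if h : j < k₁ S then σ ⟨j, h⟩ else false

/-- **The abstract gates of the sandwich circuit around the block.** [folklore] -/
def aoCirc (σ : Fin (k₁ S) → Bool) : List AO :=
  aoHad n (k₁ S + k₂ S) ++ aoBlock S n ++ aoPhase n (k₁ S + k₂ S) (σNat S σ) ++ aoHad n (k₁ S)

variable {S n}

/-- The Hadamard coin layer, abstractly. [folklore] -/
theorem map_toAO_hadamardLayer (k m : ℕ) : (hadamardLayer n k m).map toAO = aoHad n k := by
  rw [hadamardLayer, coinWires, List.map_map, aoHad, ← List.map_coe_finRange_eq_range, List.map_map, List.map_map]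
  exact List.map_congr_left fun j _ => rfl

/-- The last Hadamard layer, abstractly. [folklore] -/
theorem map_toAO_yWires_hOn : ((yWires n (k₁ S) (k₂ S) (mW S)).map hOn).map toAO = aoHad n (k₁ S) := by
  rw [yWires, List.map_map, aoHad, ← List.map_coe_finRange_eq_range, List.map_map, List.map_map]
  exact List.map_congr_left fun j _ => rfl

/-- The extended flags on `ℕ`. [folklore] -/
theorem extσ_eq_σNat (σ : Fin (k₁ S) → Bool) (j : Fin (k₁ S + k₂ S)) : extσ (k₂ := k₂ S) σ j = σNat S σ j := by
  unfold extσ σNat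
  induction j using Fin.addCases with
  | left j => simp [j.isLt]
  | right j => simp

/-- The phase layer, abstractly. [folklore] -/
theorem map_toAO_phaseLayer (σ : Fin (k₁ S) → Bool) :
    (Kitaev1995.phaseLayer n (k₁ S + k₂ S) (mW S) (extσ σ)).map toAO = aoPhase n (k₁ S + k₂ S) (σNat S σ) := by
  rw [Kitaev1995.phaseLayer, phaseLayerL, List.map_flatMap, aoPhase, ← List.map_coe_finRange_eq_range,
    List.flatMap_map]
  refine List.flatMap_congr fun j _ => ?_
  rw [← extσ_eq_σNat σ j]
  split_ifs <;> rfl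

variable (S n)

/-- **The gates of the sandwich circuit, abstractly.** [folklore] -/
theorem map_toAO_sandwich (σ : Fin (k₁ S) → Bool) :
    (sandwich (blockCirc S n) σ).gates.map toAO = aoCirc S n σ := by
  rw [sandwich]
  simp only [List.map_append]
  rw [map_toAO_hadamardLayer, map_toAO_blockCirc, map_toAO_phaseLayer, map_toAO_yWires_hOn, aoCirc]

/-- **The description of the `n`-th circuit of the family.** [cite: AroraBarak2009, §6.2] -/
theorem sigmaEncode_family (P : FParams) (n : ℕ) :
    QCircuit.sigmaEncode (G := cliffordT) ⟨n, (family P).ancillas n, (family P).circ n⟩ =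
      pairE natE (pairE unE (rawE aoE))
        (n, (k₁ (spec P n) + k₂ (spec P n)) + mW (spec P n), aoCirc (spec P n) n (famσ P n)) := by
  rw [QCircuit.sigmaEncode_eq]
  show boolPair (encodeNat n) (boolPair (unaryEncodeNat ((k₁ (spec P n) + k₂ (spec P n)) + mW (spec P n)))
    (QCircuit.encode (sandwich (blockCirc (spec P n) n) (famσ P n)))) = _
  rw [encode_eq_rawE_aoE, map_toAO_sandwich]
  rfl

end PeriodFinding

end Literature.Computability.Cryptography

end
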